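import Summits.HubbardSuperconductivity.HubbardSuperconductivity.Theorems.KLProgrammeKLRegimeScaleZeroBetaWindowCells

/-!
# Route `KLProgramme`, crux K3 — engine-flow child (stmt-HubbardSuperconductivity-20437), stub (C) at `n = 0`, located item #22a «(C)-SCALE0-PT2»,
# β-layer (β1): THE TIME-GRID READER — the lattice's time SUM is bounded by the octave table of the `δ`-FATTENED profiles

Seat hubbard-kl-k3c5-p1 (g14; owner of #22a).  The lattice object behind the certified rows `bS₀, bS₁, bS₂ᴱ` of the assembly
(`…FlowReadScaleZeroAssembly.twoLegRead_frameZero_of_sunsetData`) is a SUM over the `4M` grid times `τ_j = jβ/4M`, not the integral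
`I(β) = ∫_{(0,β]} E_β(τ)²·Ē_β(β − τ) dτ` that p1 g19's β-layer reads (`…ScaleZeroBetaWindowReduction` D5 window reduction `I(kβ) ≤ I(β)`,
`…ScaleZeroBetaWindowCells` D6 octave table).  No Lipschitz / total-variation constant is needed to pass from the sum to the integral: if the certified
β = ∞ profiles are FATTENED by `δ` — `p⁺(t) ≥ sup_{|u−t|≤δ} p(u)`, which the kit produces by widening each step of its enclosure — then every image sum at a
grid time is dominated by the fattened image sum on the whole grid cell to its left (`tsum_profile_le_of_fattened`), so the grid sum is `≤` the INTEGRAL of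
the fattened sunset shape (`sunsetShape_gridSum_le_lintegral`, grid spacing `β/n ≤ δ`), and D5/D6 apply verbatim to `(p⁺, q⁺)`:
**`sunsetShape_gridSum_le_of_octaveTable`** — one `K × N` octave table of the fattened profiles bounds the grid sunset sum for EVERY `β′ ≥ β₀` and EVERY
grid with `β′/n ≤ δ` (at `n = 4M`, `M ≥ klEngM₃ ≥ 2¹⁰β²`: `β/4M ≤ 2⁻¹²/β`, so any `δ ≥ 10⁻⁵` serves).  §1 is the abstract cell-majorant lemma.

Pure measure theory in `ℝ≥0∞`; no definitions; nothing here asserts (C), any stub of 20437, K3 or superconductivity.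
References: BGM 2006 §2.3 (2.17)–(2.20) (the time grid) [cite: BenfattoGiulianiMastropietro2006].
-/

noncomputable section

namespace Summit.HubbardSuperconductivity.HubbardSuperconductivity.Theorems.KLRegimeSplit

set_option linter.dupNamespace false -- summit = problem name (single-conjunct summit), D-0017

open MeasureTheory Set Finset
open scoped ENNReal

/-! ## §1 A grid sum is below the integral of any cell majorant -/

/-- **Cell majorant ⇒ grid sum ≤ integral**: if `g i ≤ G τ` for all `τ` in the `i`-th cell `(iε, iε + ε]` (`i < n`), then
`Σ_{i<n} ε·g i ≤ ∫_{(0, nε]} G`. -/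
theorem gridSum_le_setLIntegral_of_cellMajorant (g : ℕ → ℝ≥0∞) (G : ℝ → ℝ≥0∞) {ε : ℝ} (hε : 0 ≤ ε) (n : ℕ)
    (hG : ∀ i : ℕ, i < n → ∀ τ : ℝ, (i : ℝ) * ε < τ → τ ≤ (i : ℝ) * ε + ε → g i ≤ G τ) :
    ∑ i ∈ Finset.range n, ENNReal.ofReal ε * g i ≤ ∫⁻ τ in Ioc 0 ((n : ℝ) * ε), G τ := by
  rw [← sum_setLIntegral_Ioc_eq G hε n]
  refine Finset.sum_le_sum fun i hi => ?_
  rw [Finset.mem_range] at hi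
  calc ENNReal.ofReal ε * g i = ∫⁻ _ in Ioc ((i : ℝ) * ε) ((i : ℝ) * ε + ε), g i := by
        rw [setLIntegral_const, Real.volume_Ioc, mul_comm]
        congr 2
        ring
    _ ≤ ∫⁻ τ in Ioc ((i : ℝ) * ε) ((i : ℝ) * ε + ε), G τ :=
        setLIntegral_mono' measurableSet_Ioc fun τ hτ => hG i hi τ hτ.1 hτ.2

/-! ## §2 Fattened profiles dominate shifted image sums -/

/-- **`δ`-fattening dominates `δ`-shifts of the periodisation**: if `p u ≤ p⁺ t` whenever `|u − t| ≤ δ`, then for `|τ′ − τ| ≤ δ` and any period `γ`,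
`Σ_m p(τ′ + mγ) ≤ Σ_m p⁺(τ + mγ)`. -/
theorem tsum_profile_le_of_fattened {p pf : ℝ → ℝ≥0∞} {δ : ℝ} (hpf : ∀ t u : ℝ, |u - t| ≤ δ → p u ≤ pf t) (γ : ℝ) {τ τ' : ℝ}
    (h : |τ' - τ| ≤ δ) : ∑' m : ℤ, p (τ' + m * γ) ≤ ∑' m : ℤ, pf (τ + m * γ) :=
  ENNReal.tsum_le_tsum fun m => hpf _ _ (by rw [show τ' + m * γ - (τ + m * γ) = τ' - τ by ring]; exact h)

/-! ## §3 The grid sunset sum is below the integral of the fattened sunset shape -/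

/-- **Grid sunset sum ≤ fattened integral**: for `β > 0`, `n ≥ 1` grid cells of size `β/n ≤ δ`, profiles `p, q` with `δ`-fattenings `p⁺, q⁺`:
`Σ_{i<n} (β/n)·E^{p}_β(τ_{i+1})²·E^{q}_β(β − τ_{i+1}) ≤ ∫_{(0,β]} E^{p⁺}_β(τ)²·E^{q⁺}_β(β − τ) dτ`, `τ_{i+1} = (i+1)β/n`, `E^{p}_β(τ) = Σ_m p(τ + mβ)`. -/
theorem sunsetShape_gridSum_le_lintegral {p q pf qf : ℝ → ℝ≥0∞} {δ : ℝ} (hpf : ∀ t u : ℝ, |u - t| ≤ δ → p u ≤ pf t)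
    (hqf : ∀ t u : ℝ, |u - t| ≤ δ → q u ≤ qf t) {β : ℝ} (hβ : 0 < β) (n : ℕ) (hn : 0 < n) (hδ : β / n ≤ δ) :
    ∑ i ∈ Finset.range n, ENNReal.ofReal (β / n) *
        ((∑' m : ℤ, p (((i : ℝ) + 1) * (β / n) + m * β)) ^ 2 * (∑' m : ℤ, q (β - ((i : ℝ) + 1) * (β / n) + m * β))) ≤
      ∫⁻ τ in Ioc 0 β, (∑' m : ℤ, pf (τ + m * β)) ^ 2 * (∑' m : ℤ, qf (β - τ + m * β)) := by
  have hnr : (0 : ℝ) < n := by exact_mod_cast hn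
  have hε : 0 ≤ β / n := by positivity
  have hnε : (n : ℝ) * (β / n) = β := by field_simp
  have h := gridSum_le_setLIntegral_of_cellMajorant
    (fun i : ℕ => (∑' m : ℤ, p (((i : ℝ) + 1) * (β / n) + m * β)) ^ 2 * (∑' m : ℤ, q (β - ((i : ℝ) + 1) * (β / n) + m * β)))
    (fun τ => (∑' m : ℤ, pf (τ + m * β)) ^ 2 * (∑' m : ℤ, qf (β - τ + m * β))) hε n ?_
  · rwa [hnε] at h
  intro i _ τ h1 h2
  -- the grid time `τ_{i+1} = (i+1)β/n` is within `β/n ≤ δ` of every `τ` in the cell `(iβ/n, (i+1)β/n]`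
  have hdist : |((i : ℝ) + 1) * (β / n) - τ| ≤ δ := by
    rw [abs_le]; constructor <;> nlinarith
  have hdist' : |β - ((i : ℝ) + 1) * (β / n) - (β - τ)| ≤ δ := by
    rw [show β - ((i : ℝ) + 1) * (β / n) - (β - τ) = -(((i : ℝ) + 1) * (β / n) - τ) by ring, abs_neg]; exact hdist
  have hE := tsum_profile_le_of_fattened hpf β hdist
  have hEbar := tsum_profile_le_of_fattened hqf β hdist'
  exact mul_le_mul' (pow_le_pow_left' hE 2) hEbar

/-! ## §4 The octave table of the fattened profiles bounds every grid sunset sum -/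

/-- **TIME-GRID READER**: with `K ≥ 1` β-cells of the octave `[β₀, 2β₀]`, `N ≥ 1` `s`-cells, and a table `M i j` enclosing the rescaled FATTENED sunset
integrand `(Σ_m p⁺(β(s+m)))²·(Σ_m q⁺(β(1−s+m)))` on (β-cell `i`) × (s-cell `j`) whose row totals are `≤ S` (exactly the hypotheses of
`sunsetShape_le_of_octaveTable` for `(p⁺, q⁺)`), the GRID sunset sum of the raw profiles obeys, for EVERY `β′ ≥ β₀` and EVERY `n ≥ 1` with `β′/n ≤ δ`:
`Σ_{i<n} (β′/n)·E^{p}_{β′}(τ_{i+1})²·E^{q}_{β′}(β′ − τ_{i+1}) ≤ S`. -/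
theorem sunsetShape_gridSum_le_of_octaveTable {p q pf qf : ℝ → ℝ≥0∞} {δ : ℝ} (hpf : ∀ t u : ℝ, |u - t| ≤ δ → p u ≤ pf t)
    (hqf : ∀ t u : ℝ, |u - t| ≤ δ → q u ≤ qf t) (hpfm : Measurable pf) (hqfm : Measurable qf) {β₀ : ℝ} (hβ₀ : 0 < β₀)
    (K N : ℕ) (hK : 0 < K) (hN : 0 < N) (M : ℕ → ℕ → ℝ≥0∞) {S : ℝ≥0∞}
    (hM : ∀ i : ℕ, i < K → ∀ j : ℕ, j < N → ∀ β : ℝ, β₀ * (1 + (i : ℝ) / K) ≤ β → β ≤ β₀ * (1 + ((i : ℝ) + 1) / K) →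
      ∀ s : ℝ, (j : ℝ) / N < s → s ≤ ((j : ℝ) + 1) / N →
        (∑' m : ℤ, pf (β * (s + m))) ^ 2 * (∑' m : ℤ, qf (β * (1 - s + m))) ≤ M i j)
    (hS : ∀ i : ℕ, i < K → ENNReal.ofReal (β₀ * (1 + ((i : ℝ) + 1) / K)) * ∑ j ∈ Finset.range N, ENNReal.ofReal (1 / N) * M i j ≤ S)
    {β' : ℝ} (hβ' : β₀ ≤ β') (n : ℕ) (hn : 0 < n) (hδ : β' / n ≤ δ) :
    ∑ i ∈ Finset.range n, ENNReal.ofReal (β' / n) *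
        ((∑' m : ℤ, p (((i : ℝ) + 1) * (β' / n) + m * β')) ^ 2 * (∑' m : ℤ, q (β' - ((i : ℝ) + 1) * (β' / n) + m * β'))) ≤ S :=
  (sunsetShape_gridSum_le_lintegral hpf hqf (lt_of_lt_of_le hβ₀ hβ') n hn hδ).trans
    (sunsetShape_le_of_octaveTable hpfm hqfm hβ₀ K N hK hN M hM hS hβ')

end Summit.HubbardSuperconductivity.HubbardSuperconductivity.Theorems.KLRegimeSplit

end
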